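/-
Copyright (c) 2026 the pub-hodgecm-mathlib formalisation cell (harness21).  Prover seat hodgecm-mathlib-LH4-p07 (g11) (Track A «FOUR-FRAME» free hand routed by the
CHAIR VALVE to L1; U1 desk K2E3-p06 (g6) 00:32:01Z (F-rest) → LH4-p07), Track B «K2-LIT», #184♮ = hLiu418 = stmt-HodgeConjecture-24832; U1-glob LEVEL 2 (END pen
K2E3-p06 (g6)).  THE CLEARED REST AT THE KERNEL PLACE: `(s − ½)·(c · HEAD_{∞ × (T∖v₀)}(s) · sc¹^{T}(s) · ∏_{v∈D} P_v(s))` continues holomorphically to `{0 < re s}` —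
hypothesis-first on the FACES SPLIT of the head (arch blocks + flat smooth local families BY VALUE), the finite-place letters DISCHARGED INSIDE by ★ p863501
`K2LiuKindOneSingularLocalFace` + ★ p863592∕p863609 `K2LiuKindOneSingularCornerTraceLetter`, assembled by ★ p863286 `K2LiuKindOneSingularGlobalAssembler`.
-/
import Summits.HodgeConjecture.HodgeConjecture.Theorems.K2LiuKindOneSingularLocalFace            -- ★ p863501 (this seat): `exists_localFace_kindOneSingular`
import Summits.HodgeConjecture.HodgeConjecture.Theorems.K2LiuKindOneSingularCornerTraceLetter    -- ★ p863592∕p863609 (this seat): `cornerTrace_ne_zero`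
import Summits.HodgeConjecture.HodgeConjecture.Theorems.K2LiuKindOneSingularGlobalAssembler       -- ★ p863286 (this seat): `exists_Gc_of_placeLetters_scalarK1_cm`
import HarnessLib

/-!
# Crux `HLiu418`, U1-glob LEVEL 2 ∕ socket #41 KIND 1 a♮ — `K2LiuLocalKernelClearedRestAtKernelPlace`: THE CLEARED REST AT THE KERNEL PLACE
# `∃ Gc` holomorphic on `{0 < re}` with `(s − ½)·(c · HT(s) · ζ_{L⁺}^T(2s)∕(ζ_{L⁺}^T(2s+1)·L^T(2s+2, ε_{L∕L⁺})) · ∏_{v∈D} P_v(s)) = Gc(s)` on `{1 < re}` (slots `Gc hGc hGR`)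

Cell `hodgecm-mathlib`, crux item hLiu418 = `stmt-HodgeConjecture-24832`, route `HCCMUnconditional`; squad K2, strike line L1; U1 desk ∕ END pen K2E3-p06 (g6) (RECIPE
eb0ff1dc8da31b24, ★ p863409 LEVEL 1 ED. 2, K2E3-p28 (g3)'s `exists_kernelPlace_tailPackage`).  THEOREMS ONLY (no `def`, no instance, no notation, no named-fact hypothesis, no `sorry`,
default heartbeats); lane `--supports stmt-HodgeConjecture-24832 --as helper`.

THE OBJECT.  K2E3-p28's tail package at the kernel place `v₀` writes, on `{n∕2 < re s}`,
`c • W_S(f_s)(h) = Fn(s) · ((c:ℂ) · HT(s, Λg·h) · sc¹^{↑T}(s) · ∏_{v∈D} P_v(s))` with `HT` = ★ FILE 2's head over `∞ × (T ∖ v₀)` (an integral of the corner character against the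
REST `rT` of the section, pure at `v₀` only).  LEVEL 2 needs the REST CLEARED: `∃ Gc` holomorphic on `{0 < re}` with `(s − ½)·(c · HT(s) · sc¹^{↑T}(s) · ∏ P_v(s)) = Gc(s)` on `{1 < re}`.
DESIGN (this seat's census 00:33Z): `rT` is NOT a pure tensor across `∞` and the `w ∈ T∖v₀` in general (the away part is an arbitrary `K`-finite section), so the FACES SPLIT of
`s ↦ HT(s, Λg·h)` — a finite SUM over pure tensors `i ∈ I` of an archimedean block `A i` times a product over the finite places `v ∈ Tw` of CORNER-TWISTED LOCAL INTEGRALS of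
`K₀_v`-flat smooth local Siegel families `G i v` — is the ONE by-value input (`hsplit`; producer = (E6′)-type away purity + Fubini with integrability, K2E3-p28∕K2E3-p06's road),
together with the arch continuations `(Ac, hAc, hA)` (K2E5-p16's (Φ-S1)–(iii) assembly).  Everything at the finite places is DISCHARGED INSIDE: per `(i, v)` the place letter
`(Gn, hGn, hW)` by ★ `exists_localFace_kindOneSingular` (its `hτ` by ★ `cornerTrace_ne_zero` from `σ ≠ 0`, `c σ = −σ` — the (K1a-1) dress of the rank-one index), then ★
`exists_Gc_of_placeLetters_scalarK1_cm` (sum form, `H := Unit`).  Output = U1-glob LEVEL 2's slots `Gc hGc hGR` (K2E3-p14 (g9) slot table §B) with the (F-V) WITNESS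
`Gc = c · (Σ_i Ac i · ∏_v Gn i v) · G · ∏ P_v`, `(s − ½)·sc¹^{↑T} = G` on `½ < re`.
* §1 **`exists_clearedRest_kernelPlace`**.
HONEST LABEL.  Count-neutral helper; `hsplit` and the arch letters are HYPOTHESES; nothing here closes a socket: `HC_CM` is proved only modulo the 7 printed citations (2 remaining
named inputs: hLiu418 = `stmt-HodgeConjecture-24832`, h413 = `stmt-HodgeConjecture-24833`) until rung 0 closes.

## References
* [KudlaRallis1994] S. Kudla, S. Rallis, *A regularized Siegel–Weil formula: the first term identity*, Ann. of Math. 140 (1994): §2 (2.10)–(2.12).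
* [Tan1999] V. Tan, *Poles of Siegel Eisenstein series on U(n,n)*, Canad. J. Math. 51 (1999): §3, §4 Prop. 4.8.
* [KudlaSweet1997] S. Kudla, W. J. Sweet, *Degenerate principal series representations for U(n,n)*, Israel J. Math. 98 (1997): §1.
* [HarrisKudlaSweet1996] M. Harris, S. Kudla, W. J. Sweet, J. AMS 9 (1996): §6 (6.14)–(6.16).
-/

set_option autoImplicit false
set_option linter.dupNamespace false -- the mandated namespace repeats `HodgeConjecture.HodgeConjecture`

noncomputable section

open scoped Classical NNReal ENNReal ComplexConjugate
open NumberField IsDedekindDomain Matrix MeasureTheory Topology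
open Literature.NumberTheory.GaloisRepresentations.IsNonarchimedeanLocalField
open Literature.NumberTheory.Automorphic Literature.NumberTheory.Automorphic.UnitaryGroup Literature.NumberTheory.GaloisRepresentations
open Literature.NumberTheory.LFunctions
open Literature.NumberTheory.GelbartRogawski1991 Literature.NumberTheory.GelbartRogawski1991.GRConstruction
open Literature.NumberTheory.GelbartRogawski1991.UnitaryDualPair Literature.NumberTheory.GelbartRogawski1991.UnitaryDualPair.LocalSplitting
open Literature.NumberTheory.K2Lit Literature.NumberTheory.K2Lit.SiegelDoubled Literature.NumberTheory.K2Lit.LocalSiegelDoubled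
open Summit.HodgeConjecture.HodgeConjecture.Cruxes.HLiu418.K2LiuQRationalDefs
open Summit.HodgeConjecture.HodgeConjecture.Cruxes.HLiu418.K2LiuSiegelUnipotentLocalDefs (unipDeltaLoc)
open Summit.HodgeConjecture.HodgeConjecture.Cruxes.HLiu418.K2LiuSiegelUnipotentFourierDefs
open Summit.HodgeConjecture.HodgeConjecture.Cruxes.HLiu418.K2LiuSiegelUnipotentCharacters
open Summit.HodgeConjecture.HodgeConjecture.Cruxes.HLiu418.K2LiuKindOneSingularLocalFace (exists_localFace_kindOneSingular)
open Summit.HodgeConjecture.HodgeConjecture.Cruxes.HLiu418.K2LiuKindOneSingularCornerTraceLetter (cornerTrace_ne_zero)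
open Summit.HodgeConjecture.HodgeConjecture.Cruxes.HLiu418.K2LiuKindOneSingularGlobalAssembler (exists_Gc_of_placeLetters_scalarK1_cm)

namespace Summit.HodgeConjecture.HodgeConjecture.Cruxes.HLiu418.K2LiuLocalKernelClearedRestAtKernelPlace

variable (L : Type) [Field L] [NumberField L] [IsCMField L] {N M : ℕ} (e : Fin N × Fin M ≃ Fin 2)
  (dV : Fin N → L) (hdV : ∀ i, IsCMField.complexConj L (dV i) = dV i) (hdV0 : ∀ i, dV i ≠ 0)
  (dW : Fin M → L) (hdW : ∀ i, IsCMField.complexConj L (dW i) = dW i) (hdW0 : ∀ i, dW i ≠ 0)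

set_option maxHeartbeats 800000 in -- MEASURED class of the K2Lit CM telescope statements (★ `K2LiuUnipDeltaLocIntegralTransport` §2 ∕ ★ p863501 §3: 200 000 ✗ `whnf` on the binder telescope)
include hdV0 hdW0 in
/-- **THE CLEARED REST AT THE KERNEL PLACE (U1-glob LEVEL 2's `Gc hGc hGR`, with witness).**  At the doubled CM datum (`n = 2`): a finite set `T` of places of `L⁺` (the tail package's,
the K1 scalar of record read at `↑T`), a finite set `Tw` of places (the head's, `T ∖ v₀`), Haar measures `νv v` on the global-comap subgroups `unipDeltaLoc v`, unitary local characters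
`χv v`, an IMAGINARY non-zero corner entry `σ` (`S♭ = single 1 1 σ`), the local components `hpt v ∈ H_v` of the translate `Λg·h`, a constant `c`, the head `HT : ℂ → ℂ`, the finite shell
factors `(D, P)` holomorphic on `{0 < re}`; BY VALUE: the archimedean blocks `A i` with continuations `Ac i` (holomorphic on `{0 < re}`, `= A i` on `{1 < re}`), per `(i ∈ I, v ∈ Tw)` a
compact open `K₀ v` with the Iwasawa property and a `K₀ v`-FLAT family `G i v` of smooth Siegel sections of `I_v(s, χ_v)`, and the FACES SPLIT `hsplit` of `HT` on `{1 < re}` into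
`Σ_{i∈I} A i s · ∏_{v∈Tw} ∫ conj ψ_{S♭}(ι_v y) · G i v s ((w_Δ)_v · y · hpt v) dνv(y)`.  THEN `∃ Gc : ℂ → ℂ` holomorphic on `{0 < re}` with
`(s − ½)·(c · HT s · sc¹^{↑T}(s) · ∏_{v∈D} P v s) = Gc s` on `{1 < re}`, and the witness `Gc = c·(Σ_i Ac i·∏_v Gn i v)·G·∏ P_v` with `(s − ½)·sc¹^{↑T} = G` on `½ < re` and every
`s ↦ Gn i v s` (`i ∈ I`, `v ∈ Tw`) `q_v`-rational regular at every `s₀ ∈ {0 < re}` — the finite-place letters by ★ `exists_localFace_kindOneSingular` (`hτ` ★ `cornerTrace_ne_zero`), the assembly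
by ★ `exists_Gc_of_placeLetters_scalarK1_cm`. [cite: KudlaRallis1994, §2 (2.10)–(2.12)] [cite: Tan1999, §3; §4 Prop. 4.8] [cite: KudlaSweet1997, §1] [cite: HarrisKudlaSweet1996, §6 (6.14)–(6.16)] -/
theorem exists_clearedRest_kernelPlace
    (T Tw : Finset (HeightOneSpectrum (𝓞 (Fp L))))
    [∀ v : HeightOneSpectrum (𝓞 (Fp L)), MeasurableSpace ↥(unipDeltaLoc L e dV hdV dW hdW v)] [∀ v : HeightOneSpectrum (𝓞 (Fp L)), BorelSpace ↥(unipDeltaLoc L e dV hdV dW hdW v)]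
    (νv : ∀ v : HeightOneSpectrum (𝓞 (Fp L)), Measure ↥(unipDeltaLoc L e dV hdV dW hdW v)) [∀ v, (νv v).IsHaarMeasure]
    (χv : ∀ v : HeightOneSpectrum (𝓞 (Fp L)), ∀ w : PlacesOver L v, (w.1.adicCompletion L)ˣ →* ℂˣ)
    (hχ : ∀ (v : HeightOneSpectrum (𝓞 (Fp L))) (w' : PlacesOver L v) (x : (w'.1.adicCompletion L)ˣ), ‖((χv v w' x : ℂˣ) : ℂ)‖ = 1)
    (σ : L) (hσ0 : σ ≠ 0) (hσc : IsCMField.complexConj L σ = -σ)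
    (hpt : ∀ v : HeightOneSpectrum (𝓞 (Fp L)), UnitaryGroup.localPi L (IsCMField.complexConj L) (2 + 2) (hermD L e dV hdV dW hdW) v)
    (c : ℂ) (HT : ℂ → ℂ)
    {κ : Type*} (D : Finset κ) (P : κ → ℂ → ℂ) (hP : ∀ v ∈ D, DifferentiableOn ℂ (P v) {s : ℂ | 0 < s.re})
    {ι' : Type*} (I : Finset ι') (A Ac : ι' → ℂ → ℂ) (hAc : ∀ i ∈ I, DifferentiableOn ℂ (Ac i) {s : ℂ | 0 < s.re})
    (hA : ∀ i ∈ I, ∀ s : ℂ, 1 < s.re → A i s = Ac i s)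
    (K₀ : ∀ v : HeightOneSpectrum (𝓞 (Fp L)), Subgroup (UnitaryGroup.localPi L (IsCMField.complexConj L) (2 + 2) (hermD L e dV hdV dW hdW) v))
    (hK₀ : ∀ v ∈ Tw, IsCompact (K₀ v : Set (UnitaryGroup.localPi L (IsCMField.complexConj L) (2 + 2) (hermD L e dV hdV dW hdW) v)) ∧
      IsOpen (K₀ v : Set (UnitaryGroup.localPi L (IsCMField.complexConj L) (2 + 2) (hermD L e dV hdV dW hdW) v)))
    (hIw : haveI : Algebra.IsQuadraticExtension (Fp L) L := IsCMField.isQuadraticExtension L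
      ∀ v ∈ Tw, ∀ g : UnitaryGroup.localPi L (IsCMField.complexConj L) (2 + 2) (hermD L e dV hdV dW hdW) v,
        ∃ p, IsSiegelDelta (Fp L) L (IsCMField.complexConj L) (complexConj_imagUnit L) (imagUnit_ne_zero L) (imagUnit_mul_self L)
          v 2 (gramR_isSymm L e dV hdV dW hdW) (hermD_eq_map_gramD L e dV hdV dW hdW) p ∧ ∃ k ∈ K₀ v, g = p * k)
    (G : ι' → ∀ v : HeightOneSpectrum (𝓞 (Fp L)), ℂ → UnitaryGroup.localPi L (IsCMField.complexConj L) (2 + 2) (hermD L e dV hdV dW hdW) v → ℂ)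
    (hSieg : haveI : Algebra.IsQuadraticExtension (Fp L) L := IsCMField.isQuadraticExtension L
      ∀ i ∈ I, ∀ v ∈ Tw, ∀ s, IsLocalSiegelSection (Fp L) L (IsCMField.complexConj L) (complexConj_imagUnit L) (imagUnit_ne_zero L) (imagUnit_mul_self L)
        v 2 (gramR_isSymm L e dV hdV dW hdW) (hermD_eq_map_gramD L e dV hdV dW hdW) (χv v) s (G i v s))
    (hsm : ∀ i ∈ I, ∀ v ∈ Tw, ∀ s, IsSmooth (Fp L) L (IsCMField.complexConj L) v 2 (G i v s))
    (hflat : ∀ i ∈ I, ∀ v ∈ Tw, ∀ s s' : ℂ, ∀ k ∈ K₀ v, G i v s k = G i v s' k)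
    (hsplit : ∀ s : ℂ, 1 < s.re → HT s = ∑ i ∈ I, A i s * ∏ v ∈ Tw,
      ∫ y : ↥(unipDeltaLoc L e dV hdV dW hdW v), conj ((unipDeltaChar L e dV hdV dW hdW (Matrix.single 1 1 σ)
            (locToAdelic L e dV hdV dW hdW v (y : UnitaryGroup.localPi L (IsCMField.complexConj L) (2 + 2) (hermD L e dV hdV dW hdW) v)) : ℂ)) *
          G i v s (UnitaryGroup.evalPlace (Fp L) L (IsCMField.complexConj L) (2 + 2) (hermD L e dV hdV dW hdW) v
                (UnitaryGroup.finPart (Fp L) L (IsCMField.complexConj L) (2 + 2) (hermD L e dV hdV dW hdW) (SiegelDoubled.weylDelta L e dV hdV dW hdW)) *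
            (y : UnitaryGroup.localPi L (IsCMField.complexConj L) (2 + 2) (hermD L e dV hdV dW hdW) v) * hpt v) ∂(νv v)) :
    ∃ Gc : ℂ → ℂ, DifferentiableOn ℂ Gc {s : ℂ | 0 < s.re} ∧
      (∀ s : ℂ, 1 < s.re →
        (s - 1 / 2) * (c * HT s *
          (partialStandardL (↑T : Set (HeightOneSpectrum (𝓞 (Fp L)))) (fun _ => {1}) (2 * s) /
            (partialStandardL (↑T : Set (HeightOneSpectrum (𝓞 (Fp L)))) (fun _ => {1}) (2 * s + 1) *
              partialStandardL (↑T : Set (HeightOneSpectrum (𝓞 (Fp L)))) (fun v => {(quadraticHeckeCharCM L).valueAtUniformizer v}) (2 * s + 2))) *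
          ∏ v ∈ D, P v s) = Gc s) ∧
      ∃ G : ℂ → ℂ, DifferentiableOn ℂ G {s : ℂ | 0 < s.re} ∧
        (∀ s : ℂ, 1 / 2 < s.re →
          (s - 1 / 2) *
            (partialStandardL (↑T : Set (HeightOneSpectrum (𝓞 (Fp L)))) (fun _ => {1}) (2 * s) /
              (partialStandardL (↑T : Set (HeightOneSpectrum (𝓞 (Fp L)))) (fun _ => {1}) (2 * s + 1) *
                partialStandardL (↑T : Set (HeightOneSpectrum (𝓞 (Fp L)))) (fun v => {(quadraticHeckeCharCM L).valueAtUniformizer v}) (2 * s + 2))) = G s) ∧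
        ∃ Gn : ι' → HeightOneSpectrum (𝓞 (Fp L)) → ℂ → ℂ,
          (∀ i ∈ I, ∀ v ∈ Tw, ∀ s₀ : ℂ, 0 < s₀.re → IsQRationalRegularAt (residueFieldCard (v.adicCompletion (Fp L))) s₀ (Gn i v)) ∧
          ∀ s, Gc s = c * (∑ i ∈ I, Ac i s * ∏ v ∈ Tw, Gn i v s) * G s * ∏ v ∈ D, P v s := by
  -- the finite-place letters, per `(i ∈ I, v ∈ Tw)`, by ★ `exists_localFace_kindOneSingular` (`hτ` ★ `cornerTrace_ne_zero`)
  have hτ := cornerTrace_ne_zero L e dV hdV hdV0 dW hdW hdW0 hσ0 hσc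
  have key : ∀ i ∈ I, ∀ v ∈ Tw, ∃ Gn : ℂ → UnitaryGroup.localPi L (IsCMField.complexConj L) (2 + 2) (hermD L e dV hdV dW hdW) v → ℂ,
      (∀ s₀ : ℂ, 0 < s₀.re → ∀ h, IsQRationalRegularAt (residueFieldCard (v.adicCompletion (Fp L))) s₀ (fun s => Gn s h)) ∧
      ∀ s : ℂ, 1 < s.re → ∀ h : UnitaryGroup.localPi L (IsCMField.complexConj L) (2 + 2) (hermD L e dV hdV dW hdW) v,
        ∫ y : ↥(unipDeltaLoc L e dV hdV dW hdW v), conj ((unipDeltaChar L e dV hdV dW hdW (Matrix.single 1 1 σ)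
              (locToAdelic L e dV hdV dW hdW v (y : UnitaryGroup.localPi L (IsCMField.complexConj L) (2 + 2) (hermD L e dV hdV dW hdW) v)) : ℂ)) *
            G i v s (UnitaryGroup.evalPlace (Fp L) L (IsCMField.complexConj L) (2 + 2) (hermD L e dV hdV dW hdW) v
                  (UnitaryGroup.finPart (Fp L) L (IsCMField.complexConj L) (2 + 2) (hermD L e dV hdV dW hdW) (SiegelDoubled.weylDelta L e dV hdV dW hdW)) *
              (y : UnitaryGroup.localPi L (IsCMField.complexConj L) (2 + 2) (hermD L e dV hdV dW hdW) v) * h) ∂(νv v) = Gn s h :=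
    fun i hi v hv => exists_localFace_kindOneSingular L e dV hdV hdV0 dW hdW hdW0 v (νv v) (χv v) (hχ v) (K₀ v) (hK₀ v hv) (hIw v hv) (G i v)
      (hSieg i hi v hv) (hsm i hi v hv) (hflat i hi v hv) σ hτ
  choose Gn hGn hW using key
  -- the place letters as total functions of `(i, v)` at the point `hpt v`
  let Gn' : ι' → HeightOneSpectrum (𝓞 (Fp L)) → ℂ → ℂ := fun i v s =>
    if h : i ∈ I ∧ v ∈ Tw then Gn i h.1 v h.2 s (hpt v) else 0
  have hGn' : ∀ i ∈ I, ∀ v ∈ Tw, ∀ s₀ : ℂ, 0 < s₀.re → IsQRationalRegularAt (residueFieldCard (v.adicCompletion (Fp L))) s₀ (Gn' i v) := by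
    intro i hi v hv s₀ hs₀
    have h := hGn i hi v hv s₀ hs₀ (hpt v)
    simp only [Gn', dif_pos (And.intro hi hv)]
    exact h
  -- ★ the assembler (sum form) at `H := Unit`
  obtain ⟨Gc, hGc, hGR, Gsc, hGsc, hsc, hw⟩ := exists_Gc_of_placeLetters_scalarK1_cm L (T'' := (↑T : Set (HeightOneSpectrum (𝓞 (Fp L))))) T.finite_toSet
    (fun s (_ : Unit) => c * HT s *
      (partialStandardL (↑T : Set (HeightOneSpectrum (𝓞 (Fp L)))) (fun _ => {1}) (2 * s) /
        (partialStandardL (↑T : Set (HeightOneSpectrum (𝓞 (Fp L)))) (fun _ => {1}) (2 * s + 1) *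
          partialStandardL (↑T : Set (HeightOneSpectrum (𝓞 (Fp L)))) (fun v => {(quadraticHeckeCharCM L).valueAtUniformizer v}) (2 * s + 2))) *
      ∏ v ∈ D, P v s)
    (fun s (_ : Unit) => HT s) c D P hP (fun s _ _ => rfl) I Tw (fun v => residueFieldCard (v.adicCompletion (Fp L)))
    (fun v _ => residueFieldCard_ne_zero _)
    (fun i s (_ : Unit) => A i s)
    (fun i v s (_ : Unit) => ∫ y : ↥(unipDeltaLoc L e dV hdV dW hdW v), conj ((unipDeltaChar L e dV hdV dW hdW (Matrix.single 1 1 σ)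
          (locToAdelic L e dV hdV dW hdW v (y : UnitaryGroup.localPi L (IsCMField.complexConj L) (2 + 2) (hermD L e dV hdV dW hdW) v)) : ℂ)) *
        G i v s (UnitaryGroup.evalPlace (Fp L) L (IsCMField.complexConj L) (2 + 2) (hermD L e dV hdV dW hdW) v
              (UnitaryGroup.finPart (Fp L) L (IsCMField.complexConj L) (2 + 2) (hermD L e dV hdV dW hdW) (SiegelDoubled.weylDelta L e dV hdV dW hdW)) *
          (y : UnitaryGroup.localPi L (IsCMField.complexConj L) (2 + 2) (hermD L e dV hdV dW hdW) v) * hpt v) ∂(νv v))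
    (fun s hs _ => hsplit s hs) (fun i s (_ : Unit) => Ac i s) (fun i hi _ => hAc i hi) (fun i hi s hs _ => hA i hi s hs)
    (fun i v s (_ : Unit) => Gn' i v s) (fun i hi v hv s₀ hs₀ _ => hGn' i hi v hv s₀ hs₀)
    (fun i hi v hv s hs _ => by
      show _ = Gn' i v s
      simp only [Gn', dif_pos (And.intro hi hv)]
      exact hW i hi v hv s hs (hpt v))
  exact ⟨fun s => Gc s (), hGc (), fun s hs => hGR s hs (), Gsc, hGsc, hsc, Gn', hGn', fun s => hw s ()⟩

end Summit.HodgeConjecture.HodgeConjecture.Cruxes.HLiu418.K2LiuLocalKernelClearedRestAtKernelPlace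

end
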